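import Summits.HodgeConjecture.CorCM.MultiFieldWeilSeparatedThreefoldBlocks
import Summits.HodgeConjecture.CorCM.MultiFieldWeilAtMostTwoThreefoldsTwoSurfacesAnyCurves
import HarnessLib

/-!
# MULTI-FIELD WEIL ENGINE — ANY NUMBER OF SIMPLE CM THREEFOLDS IN PAIRWISE SEPARATED GROUPS OF AT MOST TWO, AT MOST TWO SIMPLE CM SURFACES, ANY CM ELLIPTIC
# CURVES: the Hodge conjecture for every product of copies, given ONLY Markman's fourfold theorem

Cell `pub-hodgecm2` (COR-CM), seat b30 gen 35 (2026-08-25); count-neutral own lane MULTI-FIELD WEIL ENGINE (stem `MultiFieldWeil*`), the consumer of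
`CorCM/MultiFieldWeilSeparatedThreefoldBlocks.lean` (separated threefold blocks split, unconditional) fed by `CorCM/MultiFieldWeilAtMostTwoThreefoldsTwoSurfacesAnyCurves.lean`
(the two block theorems).  Theorems only; no definition, no named fact, no `sorry`.  HONEST FRAMING: conditional on the displayed Markman fourfold binder only; `HC_CM` is
NOT proved and not asserted — a statement about a NAMED CLASS of CM abelian varieties.

THE STATEMENT (**`hodgeConjectureFor_prod_of_separatedThreefoldPairs_of_markman`**).  `A_i ⊨ (K_i; Φ_i)` (`i ∈ I` finite, one index type) SIMPLE complex abelian varieties of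
CM type of dimension `≤ 3`; `b : I → C` a labelling of the slots such that (i) two SEXTIC slots with different labels are SEPARATED — the Galois closures of their fields in
`ℂ` differ and no totally complex quadratic subfield of one field embeds in the other —, (ii) among any three sextic slots with the same label two coincide, (iii) among
any three quartic slots two coincide; any number of quadratic slots.  Then for every `π : Fin N → I` the Hodge conjecture holds for `⨁_j A_{π j}`, GIVEN ONLY
`Markman2025_weilClasses_algebraic_abelianFourfold`; with the dominated form.  In words: **ANY NUMBER of simple CM threefolds `T₁, …, T_r` which can be grouped in pairwise
separated groups of at most two (e.g. PAIRWISE SEPARATED threefolds, `b = id`: `hodgeConjectureFor_prod_of_pairwiseSeparated_threefolds_of_markman`), at most two simple CM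
surfaces, and any CM elliptic curves: the Hodge conjecture for every `∏ T_m^{a_m} × S₀^c × S₁^d × ∏ E_e^{n_e}`.**  Two threefolds `T, T′` with `K_T = k·F`, `K_{T′} = k′·F′`
are separated as soon as `k ≄ k′` and the closures `k·L_F ≠ k′·L_{F′}` — e.g. `k ≄ k′` and `L_F ≠ L_{F′}`, or `k ≄ k′`, `F = F′` non-cyclic and `k′` not the sister
`ℚ(√(−d·disc F))` of `k = ℚ(√−d)`; this goes far beyond the FOREIGN blocks of `CorCM/MultiFieldWeilForeignBlocks.lean` (closure-composita meeting in a totally real field).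

PROOF.  `hodgeConjectureFor_prod_of_separatedLabels` (previous file) asks for the Hodge conjecture inside each block.  The block of a label `c`: its members are curves or
threefolds `t` with `b t = c` (a sextic slot through a sextic field of label `c` has that label, `label_eq_of_ringHom_ringHom`), at most two of the latter (ii) — gen 35's
`hodgeConjectureFor_prod_threefoldBlock_of_markman` (two simple threefolds × any curves, Markman 4).  The block `none`: surfaces and curves, (iii) — gen 35's unconditional
`hodgeConjectureFor_prod_surfaceBlock_of_atMostTwo`.

[cite: MoonenZarhin1999LowDim, Thm. (0.1), Thm. (0.2), §3 (3.1), Cor. (3.9), §5 (5.2)] [cite: Markman2025SurveySecant, Thm. 1.2] [cite: Gordon1999HodgeAVSurvey, §3 Theorem (proof), 7.4–7.7, 10.10]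
[cite: Shimura1998, §8.2 Prop. 26, §8.4 (2)] [cite: MumfordAV1970, §19 Thm. 1 and p. 169]

## References
* [MoonenZarhin1999LowDim] B. Moonen, Yu. Zarhin, Math. Ann. 315 (1999) 711–733.  [Markman2025SurveySecant] E. Markman, arXiv:2509.23403, Thm. 1.2.
  [Gordon1999HodgeAVSurvey] B. B. Gordon, *A survey of the Hodge conjecture for abelian varieties*, §3, 7.4–7.7, 10.10.  [Shimura1998] G. Shimura, *Abelian varieties with
  complex multiplication and modular functions*, §8.2, §8.4.  [MumfordAV1970] D. Mumford, *Abelian Varieties*, §19.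
-/

noncomputable section

open CategoryTheory CategoryTheory.Limits NumberField IntermediateField

namespace Summit.HodgeConjecture.CorCM.MultiFieldWeil

open Literature.AlgebraicGeometry Literature.AlgebraicGeometry.Motives Literature.AlgebraicGeometry.HodgeTheory
open Literature.AlgebraicGeometry.ComplexMultiplication (IsCMTypeRealisation)
open Literature.AlgebraicTopology.SingularHomology
open Literature.NumberTheory.ComplexMultiplication
open Literature.AlgebraicGeometry.Pohlmann1968

open scoped Classical

section Family

variable {I : Type} [Fintype I] {K : I → Type} [∀ i, Field (K i)] [∀ i, NumberField (K i)] [∀ i, IsCMField (K i)]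
  {Φ : ∀ i, CMType (K i)} {A : I → AbelianVariety ℂ} {ι : ∀ i, 𝓞 (K i) →+* End (A i)} {θ : ∀ i, K i →+* Module.End ℂ (complexBetti (A i).X 1)}
  {C : Type}

omit [Fintype I] [∀ i, IsCMField (K i)] in
/-- The CM field of a realisation of dimension `≤ 3` has degree `2`, `4` or `6`. [cite: Shimura1998, §5.2] -/
private theorem finrank_eq_or_of_dim_le_three₃₅q (hA : ∀ i, IsCMTypeRealisation (Φ i) (A i) (ι i) (θ i)) {i : I} (h3 : (A i).dim ≤ 3) :
    Module.finrank ℚ (K i) = 2 ∨ Module.finrank ℚ (K i) = 4 ∨ Module.finrank ℚ (K i) = 6 := by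
  have h := finrank_eq_two_mul_dim_of_isCMTypeRealisation (hA i)
  have hpos : 0 < Module.finrank ℚ (K i) := Module.finrank_pos
  interval_cases hd : (A i).dim <;> omega

omit [Fintype I] [∀ i, IsCMField (K i)] in
/-- An embedding of number fields `K_i ↪ K_t` makes `[K_i : ℚ]` divide `[K_t : ℚ]`. [cite: Shimura1998, §8.1] -/
private theorem finrank_dvd_of_ringHom₃₅q {i t : I} (g : K i →+* K t) : Module.finrank ℚ (K i) ∣ Module.finrank ℚ (K t) := by
  have h1 : Module.finrank ℚ ↥g.toRatAlgHom.fieldRange = Module.finrank ℚ (K i) :=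
    ((AlgEquiv.ofInjectiveField g.toRatAlgHom).toLinearEquiv.finrank_eq).symm
  rw [← h1, ← IntermediateField.finrank_top' (F := ℚ) (E := K t)]
  exact IntermediateField.finrank_dvd_of_le_right le_top

/-- **MAIN THEOREM — SEPARATED GROUPS OF AT MOST TWO THREEFOLDS, AT MOST TWO SURFACES, ANY CURVES, given ONLY Markman's fourfold theorem.**  `A_i ⊨ (K_i; Φ_i)` (`i ∈ I`
finite) SIMPLE complex abelian varieties of CM type of dimension `≤ 3`; `b : I → C` a labelling with (i) differently labelled sextic slots SEPARATED (different Galois closures,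
no common imaginary quadratic subfield), (ii) at most two sextic slots per label, (iii) at most two quartic slots; any quadratic slots.  Then the Hodge conjecture holds for
every product of copies `⨁_j A_{π j}`, GIVEN ONLY `Markman2025_weilClasses_algebraic_abelianFourfold`.  `HC_CM` is NOT asserted.
[cite: MoonenZarhin1999LowDim, Thm. (0.1), Thm. (0.2), §3 (3.1), Cor. (3.9)] [cite: Markman2025SurveySecant, Thm. 1.2] [cite: Gordon1999HodgeAVSurvey, §3 Theorem (proof), 7.5–7.7, 10.10] -/
theorem hodgeConjectureFor_prod_of_separatedThreefoldPairs_of_markman (hW4 : Markman2025_weilClasses_algebraic_abelianFourfold)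
    (hA : ∀ i, IsCMTypeRealisation (Φ i) (A i) (ι i) (θ i)) (hS : ∀ i, (A i).IsSimple) (h3 : ∀ i, (A i).dim ≤ 3) (b : I → C)
    (hsep : ∀ t t', Module.finrank ℚ (K t) = 6 → Module.finrank ℚ (K t') = 6 → b t ≠ b t' →
      normalClosure ℚ (K t) ℂ ≠ normalClosure ℚ (K t') ℂ ∧ ¬ ∃ F : IntermediateField ℚ (K t), Module.finrank ℚ F = 2 ∧ IsTotallyComplex F ∧ Nonempty (F →+* K t'))
    (hT2 : ∀ t t' t'' : I, Module.finrank ℚ (K t) = 6 → Module.finrank ℚ (K t') = 6 → Module.finrank ℚ (K t'') = 6 → b t = b t' → b t = b t'' →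
      t = t' ∨ t = t'' ∨ t' = t'')
    (hS2 : ∀ i j l : I, Module.finrank ℚ (K i) = 4 → Module.finrank ℚ (K j) = 4 → Module.finrank ℚ (K l) = 4 → i = j ∨ i = l ∨ j = l) {N : ℕ} (π : Fin N → I) :
    HodgeConjectureFor (⨁ fun j => A (π j)).dim (⨁ fun j => A (π j)).X := by
  refine hodgeConjectureFor_prod_of_separatedLabels hA hS h3 b hsep (fun c M ρ hρ => ?_) (fun M ρ hρ => ?_) π
  · -- the block of the label `c`: curves, and at most two threefolds `t₀, t₁` of label `c`
    cases M with
    | zero => exact hodgeConjectureFor_of_isDivisorGenerated _ (isDivisorGenerated_of_dim_eq_zero _ (dim_biproduct_fin_zero _))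
    | succ M =>
      obtain ⟨t₀, ht₀, -, hb₀⟩ := hρ 0
      obtain ⟨t₁, ht₁, hcov⟩ : ∃ t₁, Module.finrank ℚ (K t₁) = 6 ∧ ∀ t, Module.finrank ℚ (K t) = 6 → b t = c → t = t₀ ∨ t = t₁ := by
        by_cases hT' : ∃ t, Module.finrank ℚ (K t) = 6 ∧ b t = c ∧ t ≠ t₀
        · obtain ⟨t₁, ht₁, hb₁, hne⟩ := hT'
          refine ⟨t₁, ht₁, fun t ht hbt => ?_⟩
          rcases hT2 t₀ t₁ t ht₀ ht₁ ht (hb₀.trans hb₁.symm) (hb₀.trans hbt.symm) with h | h | h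
          · exact absurd h.symm hne
          · exact Or.inl h.symm
          · exact Or.inr h.symm
        · exact ⟨t₀, ht₀, fun t ht hbt => Or.inl (by by_contra h; exact hT' ⟨t, ht, hbt, h⟩)⟩
      refine hodgeConjectureFor_prod_threefoldBlock_of_markman hW4 hA hS ht₀ ht₁ ρ fun l => ?_
      obtain ⟨t, ht, ⟨e⟩, hbt⟩ := hρ l
      rcases finrank_eq_or_of_dim_le_three₃₅q hA (h3 (ρ l)) with h2 | h4 | h6
      · exact Or.inl h2
      · exfalso
        have h := finrank_dvd_of_ringHom₃₅q e
        rw [h4, ht] at h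
        omega
      · -- a threefold through `K_t` has the label of `t`
        exact Or.inr (hcov (ρ l) h6 ((label_eq_of_ringHom_ringHom hA h3 b hsep h6 ht (RingHom.id _) e).trans hbt))
  · -- the block `none`: surfaces and curves (a threefold's field embeds in itself)
    exact hodgeConjectureFor_prod_surfaceBlock_of_atMostTwo hA hS h3 hS2 ρ fun l h6 => hρ l ⟨ρ l, h6, ⟨RingHom.id _⟩⟩

/-- **Dominated form.** [cite: MoonenZarhin1999LowDim, Thm. (0.1), (0.2)] [cite: Markman2025SurveySecant, Thm. 1.2] [cite: MumfordAV1970, §19 Thm. 1 and p. 169] -/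
theorem hodgeConjectureFor_of_avDominatedBy_prod_of_separatedThreefoldPairs_of_markman (hW4 : Markman2025_weilClasses_algebraic_abelianFourfold)
    (hA : ∀ i, IsCMTypeRealisation (Φ i) (A i) (ι i) (θ i)) (hS : ∀ i, (A i).IsSimple) (h3 : ∀ i, (A i).dim ≤ 3) (b : I → C)
    (hsep : ∀ t t', Module.finrank ℚ (K t) = 6 → Module.finrank ℚ (K t') = 6 → b t ≠ b t' →
      normalClosure ℚ (K t) ℂ ≠ normalClosure ℚ (K t') ℂ ∧ ¬ ∃ F : IntermediateField ℚ (K t), Module.finrank ℚ F = 2 ∧ IsTotallyComplex F ∧ Nonempty (F →+* K t'))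
    (hT2 : ∀ t t' t'' : I, Module.finrank ℚ (K t) = 6 → Module.finrank ℚ (K t') = 6 → Module.finrank ℚ (K t'') = 6 → b t = b t' → b t = b t'' →
      t = t' ∨ t = t'' ∨ t' = t'')
    (hS2 : ∀ i j l : I, Module.finrank ℚ (K i) = 4 → Module.finrank ℚ (K j) = 4 → Module.finrank ℚ (K l) = 4 → i = j ∨ i = l ∨ j = l) {N : ℕ} (π : Fin N → I)
    {X : AbelianVariety ℂ} (hX : Domination.AVDominatedBy X (⨁ fun j => A (π j))) : HodgeConjectureFor X.dim X.X :=
  Domination.hodgeConjectureFor_of_avDominatedBy (hodgeConjectureFor_prod_of_separatedThreefoldPairs_of_markman hW4 hA hS h3 b hsep hT2 hS2 π) hX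

/-- **PAIRWISE SEPARATED THREEFOLDS (`b = id`).**  `A_i ⊨ (K_i; Φ_i)` SIMPLE of dimension `≤ 3` such that any two DISTINCT sextic slots are separated (different Galois
closures, no common imaginary quadratic subfield) and among any three quartic slots two coincide; any quadratic slots.  Then the Hodge conjecture holds for every product of
copies — ANY NUMBER of pairwise separated simple CM threefolds, at most two simple CM surfaces, any CM elliptic curves — GIVEN ONLY Markman's fourfold theorem (each
threefold absorbs its own curves: gen 33's roof «a simple CM threefold × any CM elliptic curves» inside each block).  `HC_CM` is NOT asserted.
[cite: MoonenZarhin1999LowDim, Thm. (0.1), Thm. (0.2), §3 (3.1), Cor. (3.9)] [cite: Markman2025SurveySecant, Thm. 1.2] -/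
theorem hodgeConjectureFor_prod_of_pairwiseSeparated_threefolds_of_markman (hW4 : Markman2025_weilClasses_algebraic_abelianFourfold)
    (hA : ∀ i, IsCMTypeRealisation (Φ i) (A i) (ι i) (θ i)) (hS : ∀ i, (A i).IsSimple) (h3 : ∀ i, (A i).dim ≤ 3)
    (hsep : ∀ t t', Module.finrank ℚ (K t) = 6 → Module.finrank ℚ (K t') = 6 → t ≠ t' →
      normalClosure ℚ (K t) ℂ ≠ normalClosure ℚ (K t') ℂ ∧ ¬ ∃ F : IntermediateField ℚ (K t), Module.finrank ℚ F = 2 ∧ IsTotallyComplex F ∧ Nonempty (F →+* K t'))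
    (hS2 : ∀ i j l : I, Module.finrank ℚ (K i) = 4 → Module.finrank ℚ (K j) = 4 → Module.finrank ℚ (K l) = 4 → i = j ∨ i = l ∨ j = l) {N : ℕ} (π : Fin N → I) :
    HodgeConjectureFor (⨁ fun j => A (π j)).dim (⨁ fun j => A (π j)).X :=
  hodgeConjectureFor_prod_of_separatedThreefoldPairs_of_markman hW4 hA hS h3 id hsep (fun _ _ _ _ _ _ h _ => Or.inl h) hS2 π

/-- **Dominated form** of the pairwise separated case. [cite: MoonenZarhin1999LowDim, Thm. (0.1), (0.2)] [cite: Markman2025SurveySecant, Thm. 1.2] [cite: MumfordAV1970, §19 Thm. 1 and p. 169] -/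
theorem hodgeConjectureFor_of_avDominatedBy_prod_of_pairwiseSeparated_threefolds_of_markman (hW4 : Markman2025_weilClasses_algebraic_abelianFourfold)
    (hA : ∀ i, IsCMTypeRealisation (Φ i) (A i) (ι i) (θ i)) (hS : ∀ i, (A i).IsSimple) (h3 : ∀ i, (A i).dim ≤ 3)
    (hsep : ∀ t t', Module.finrank ℚ (K t) = 6 → Module.finrank ℚ (K t') = 6 → t ≠ t' →
      normalClosure ℚ (K t) ℂ ≠ normalClosure ℚ (K t') ℂ ∧ ¬ ∃ F : IntermediateField ℚ (K t), Module.finrank ℚ F = 2 ∧ IsTotallyComplex F ∧ Nonempty (F →+* K t'))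
    (hS2 : ∀ i j l : I, Module.finrank ℚ (K i) = 4 → Module.finrank ℚ (K j) = 4 → Module.finrank ℚ (K l) = 4 → i = j ∨ i = l ∨ j = l) {N : ℕ} (π : Fin N → I)
    {X : AbelianVariety ℂ} (hX : Domination.AVDominatedBy X (⨁ fun j => A (π j))) : HodgeConjectureFor X.dim X.X :=
  Domination.hodgeConjectureFor_of_avDominatedBy (hodgeConjectureFor_prod_of_pairwiseSeparated_threefolds_of_markman hW4 hA hS h3 hsep hS2 π) hX

end Family

end Summit.HodgeConjecture.CorCM.MultiFieldWeil

end
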